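import Mathlib
import Summits.NavierStokesRegularity.NavierStokesRegularity.Theorems.OrthantWakeDyadicBreakBelowOneIntervalOne
import Summits.NavierStokesRegularity.NavierStokesRegularity.Theorems.OrthantWakeDyadicBreakBelowOneIntervalTwo
import Summits.NavierStokesRegularity.NavierStokesRegularity.Theorems.OrthantWakeDyadicBreakBelowOneIntervalThree
import HarnessLib

/-!
# `OrthantWake.DyadicBreakBelowOne` holds for every shell ratio in `[7/4, 2]`
# (every `ε₀ ∈ [3/4, 1]`): Barbato–Morandin–Romito's theorem on an interval of ratios

Item stmt-NavierStokesRegularity-24644 (`OrthantWake.DyadicBreakBelowOne`: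
`∀ ε₀ ∈ (0,1), ∀ X₀, ¬ NoGlobalCascade ε₀ dyadicTable X₀`, aside «open in print»).  Assembling
the ten interval certificates `not_noGlobalCascade_dyadicTable_Icc_a … _j`
(`ε₀ ∈ [3/4, 31/40], …, [39/40, 1]`; cubic Barbato–Morandin 2-mode region with weight
`w = 51/100`, rational enclosures of `D = (1+ε₀)^{97/100}`, `K = (1+ε₀)^{199/100}` and Bernstein
certificates) gives:

* `not_noGlobalCascade_dyadicTable_of_ge_three_quarters` — **for every `ε₀ ∈ [3/4, 1]` and every
  one-shell datum `X₀`, `¬ NoGlobalCascade ε₀ dyadicTable X₀`**: the viscous Katz–Pavlović /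
  dyadic lattice of the tree admits global pseudo-solutions at every defect level for EVERY shell
  ratio `1 + ε₀ ∈ [7/4, 2]` — the top quarter of the item's range, including an independent
  re-derivation of the tree's `ε₀ = 1` theorem (`not_noGlobalCascade_one_dyadicTable`, BMR 2011
  at the ratio `2`) without the sign/support hypotheses on the datum.

So the 2-mode invariant-region METHOD is not tied to the numerical value `λ = 2`; by the LEAD
census (memo RUNG-BMR-RATIO, 2026-08-28) it reaches down to `1 + ε₀ ≈ 1.62` and fails below, where
the item remains open.

HONEST FRAMING: theorems about a MODEL lattice ODE (route OrthantWake, rung TL-M2Break); nothing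
here is a statement about the Navier–Stokes equations; the item (all of `(0,1)`) is not closed;
no crux or summit is proved.
-/

noncomputable section

set_option linter.dupNamespace false

namespace Summit.NavierStokesRegularity.NavierStokesRegularity.Theorems

open Set
open Literature.Analysis.FluidPDE.TaoCascade

/-- **`DyadicBreakBelowOne` on `[3/4, 1]`: for every shell ratio `1+ε₀ ∈ [7/4, 2]` and every
one-shell datum, Theorem 4.2-level blow-up fails for the dyadic member** — case analysis over the
ten certified sub-intervals `not_noGlobalCascade_dyadicTable_Icc_a … _j`.  MODEL lattice statement;
the `ε₀ < 3/4` part of item 24644 remains open. [this file] -/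
theorem not_noGlobalCascade_dyadicTable_of_ge_three_quarters {ε₀ : ℝ} (h₁ : 3 / 4 ≤ ε₀)
    (h₂ : ε₀ ≤ 1) (X₀ : Fin 4 → ℝ) : ¬ NoGlobalCascade ε₀ dyadicTable X₀ := by
  rcases le_or_gt ε₀ (31 / 40) with ha | ha
  · exact not_noGlobalCascade_dyadicTable_Icc_a h₁ ha X₀
  rcases le_or_gt ε₀ (4 / 5) with hb | hb
  · exact not_noGlobalCascade_dyadicTable_Icc_b ha.le hb X₀
  rcases le_or_gt ε₀ (33 / 40) with hc | hc
  · exact not_noGlobalCascade_dyadicTable_Icc_c hb.le hc X₀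
  rcases le_or_gt ε₀ (17 / 20) with hd | hd
  · exact not_noGlobalCascade_dyadicTable_Icc_d hc.le hd X₀
  rcases le_or_gt ε₀ (7 / 8) with he | he
  · exact not_noGlobalCascade_dyadicTable_Icc_e hd.le he X₀
  rcases le_or_gt ε₀ (9 / 10) with hf | hf
  · exact not_noGlobalCascade_dyadicTable_Icc_f he.le hf X₀
  rcases le_or_gt ε₀ (37 / 40) with hg | hg
  · exact not_noGlobalCascade_dyadicTable_Icc_g hf.le hg X₀
  rcases le_or_gt ε₀ (19 / 20) with hh | hh
  · exact not_noGlobalCascade_dyadicTable_Icc_h hg.le hh X₀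
  rcases le_or_gt ε₀ (39 / 40) with hi | hi
  · exact not_noGlobalCascade_dyadicTable_Icc_i hh.le hi X₀
  · exact not_noGlobalCascade_dyadicTable_Icc_j hi.le h₂ X₀

/-- The item's shape on the certified range: `∀ ε₀ ∈ [3/4, 1), ∀ X₀, ¬ NoGlobalCascade ε₀
dyadicTable X₀` (the statement `DyadicBreakBelowOne` restricted to `ε₀ ≥ 3/4`). MODEL lattice
statement. [this file] -/
theorem dyadicBreakBelowOne_of_ge_three_quarters :
    ∀ ε₀ : ℝ, 3 / 4 ≤ ε₀ → ε₀ < 1 → ∀ X₀ : Fin 4 → ℝ, ¬ NoGlobalCascade ε₀ dyadicTable X₀ :=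
  fun _ h₁ h₂ X₀ => not_noGlobalCascade_dyadicTable_of_ge_three_quarters h₁ h₂.le X₀

end Summit.NavierStokesRegularity.NavierStokesRegularity.Theorems

end
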